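import Mathlib
import Summits.Ventures.PercRepro2.Defs
import Summits.Ventures.PercRepro2.Independence
import Summits.Ventures.PercRepro2.Harris
import Summits.Ventures.PercRepro2.Graph
import Summits.Ventures.PercRepro2.Exploration
import Summits.Ventures.PercRepro2.Events
import Summits.Ventures.PercRepro2.FourFunctions
import Summits.Ventures.PercRepro2.Induced
import Summits.Ventures.PercRepro2.Frontier
import Summits.Ventures.PercRepro2.ObsIndependence
import Summits.Ventures.PercRepro2.BHK
import Summits.Ventures.PercRepro2.BHKEvents
import Summits.Ventures.PercRepro2.OrderPreservation
import Summits.Ventures.PercRepro2.OrderPreservationDual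
import Summits.Ventures.PercRepro2.VdBKahn
import Summits.Ventures.PercRepro2.BHKAvoid
import Summits.Ventures.PercRepro2.R2PrimeThreeReduction
import Summits.Ventures.PercRepro2.YBridge
import Summits.Ventures.PercRepro2.Yu1Functionals
import Summits.Ventures.PercRepro2.Yu1Events
import Summits.Ventures.PercRepro2.Yu1
import Summits.Ventures.PercRepro2.LBSplit
import Summits.Ventures.PercRepro2.YDelta
import Summits.Ventures.PercRepro2.SD
import Summits.Ventures.PercRepro2.YDeltaTools
import Summits.Ventures.PercRepro2.Lambda

/-!
# The `λ < 1` weights `τ, τ₀, τ₁` (blind cell PercRepro2, typer-1; lead g6 ADDENDUM 15 (5))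

`τ := W u − P(PD) ψ` (the (Yu1Δ)-slack density: the slack is `E[1_o τ; R]`, see `LambdaSlack`),
`τ₀ := τ − (P(PD) − W) 1_b (1 − u)` (`= W` on `{b ∈ S}`, `tau0_of_mem`; `= τ` off `b`;
`= min(τ, W)` in the regime `W ≤ P(PD)`, `tau0_eq_min`; **monotone** as soon as `0 ≤ W`,
`tau0_mono`; `≥ −P(PD)`, `tau0_ge`), `τ₁ := τ₀ + (P(PD) − W) 1_b`
(`= (W u − P(PD) β) 1_{b∉S} + P(PD) 1_{b∈S}`); `β = 0` on `{b ∈ S}` is p1's `beta_eq_zero_of_mem`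
(`YDeltaTools`).
-/

namespace Summit.Ventures.PercRepro2

open UnionCluster Yu1

namespace Lambda

section Tau

variable {V : Type*} {E : Type*} [Fintype E] [DecidableEq E] [Fintype V] [DecidableEq V]
  {R : Type*} [Field R] [LinearOrder R] [IsStrictOrderedRing R]

/-- `τ(S) = W u(S) − P(PD) ψ(S)` — the (Yu1Δ)-slack density. -/
noncomputable def tau (p : E → R) (ends : E → Sym2 V) (a₁ a₂ a₃ b : V) : Set V → R :=
  fun S => (massM2 p ends a₁ a₂ a₃ b + deltaT p ends a₁ a₂ a₃ b) * u p ends a₂ a₃ S -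
    prob p (PDEvent ends a₁ a₂ a₃) * psi p ends a₂ a₃ b S

/-- `τ₀(S) = τ(S) − (P(PD) − W) 1_b(S) (1 − u(S))` (`= min(τ, W)` in the regime `W ≤ P(PD)`). -/
noncomputable def tau0 (p : E → R) (ends : E → Sym2 V) (a₁ a₂ a₃ b : V) : Set V → R :=
  fun S => tau p ends a₁ a₂ a₃ b S -
    (prob p (PDEvent ends a₁ a₂ a₃) - (massM2 p ends a₁ a₂ a₃ b + deltaT p ends a₁ a₂ a₃ b)) *
      (ind b S * (1 - u p ends a₂ a₃ S))

/-- `τ₁(S) = τ₀(S) + (P(PD) − W) 1_b(S)` (`= (W u − P(PD) β) 1_{b∉S} + P(PD) 1_{b∈S}`). -/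
noncomputable def tau1 (p : E → R) (ends : E → Sym2 V) (a₁ a₂ a₃ b : V) : Set V → R :=
  fun S => tau0 p ends a₁ a₂ a₃ b S +
    (prob p (PDEvent ends a₁ a₂ a₃) - (massM2 p ends a₁ a₂ a₃ b + deltaT p ends a₁ a₂ a₃ b)) *
      ind b S

omit [Fintype V] [DecidableEq V] [LinearOrder R] [IsStrictOrderedRing R] in
/-- `τ₀ = τ` off `b`. -/
lemma tau0_of_notMem (p : E → R) (ends : E → Sym2 V) (a₁ a₂ a₃ b : V) {S : Set V} (hbS : b ∉ S) :
    tau0 p ends a₁ a₂ a₃ b S = tau p ends a₁ a₂ a₃ b S := by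
  unfold tau0 ind
  simp [hbS]

omit [Fintype V] [DecidableEq V] [LinearOrder R] [IsStrictOrderedRing R] in
/-- `τ = W u − P(PD) β` off `b`. -/
lemma tau_of_notMem (p : E → R) (ends : E → Sym2 V) (a₁ a₂ a₃ b : V) {S : Set V} (hbS : b ∉ S) :
    tau p ends a₁ a₂ a₃ b S =
      (massM2 p ends a₁ a₂ a₃ b + deltaT p ends a₁ a₂ a₃ b) * u p ends a₂ a₃ S -
        prob p (PDEvent ends a₁ a₂ a₃) * beta p ends a₂ b S := by
  unfold tau psi ind
  simp [hbS]

omit [Fintype V] [DecidableEq V] [LinearOrder R] [IsStrictOrderedRing R] in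
/-- **`τ₀ = W` on `{b ∈ S}`** (`b ≠ a₂`). -/
lemma tau0_of_mem (p : E → R) (ends : E → Sym2 V) (a₁ a₂ a₃ b : V) (hb : b ≠ a₂) {S : Set V}
    (hbS : b ∈ S) : tau0 p ends a₁ a₂ a₃ b S = massM2 p ends a₁ a₂ a₃ b + deltaT p ends a₁ a₂ a₃ b := by
  unfold tau0 tau psi ind
  rw [beta_eq_zero_of_mem p ends hb hbS]
  simp only [Set.mem_setOf_eq, hbS, Set.indicator_of_mem, Pi.one_apply]
  ring

omit [Fintype V] [DecidableEq V] in
/-- `τ ≤ W` off `b` when `0 ≤ W`. -/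
lemma tau_le_W_of_notMem (p : E → R) (hp : IsProbVec p) (ends : E → Sym2 V) (a₁ a₂ a₃ b : V)
    (hW : 0 ≤ massM2 p ends a₁ a₂ a₃ b + deltaT p ends a₁ a₂ a₃ b) {S : Set V} (hbS : b ∉ S) :
    tau p ends a₁ a₂ a₃ b S ≤ massM2 p ends a₁ a₂ a₃ b + deltaT p ends a₁ a₂ a₃ b := by
  rw [tau_of_notMem p ends a₁ a₂ a₃ b hbS]
  have h1 := u_le_one p hp ends a₂ a₃ S
  have h2 := beta_nonneg p hp ends a₂ b S
  have h3 := prob_nonneg hp (PDEvent ends a₁ a₂ a₃)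
  nlinarith

omit [Fintype V] [DecidableEq V] in
/-- **`τ₀ is monotone`** when `0 ≤ W` (`b ≠ a₂`): off `b` it is `W u − P(PD) β` (increasing), on
`{b ∈ S}` it is the constant `W`, and `τ ≤ W` off `b`. -/
lemma tau0_mono (p : E → R) (hp : IsProbVec p) (ends : E → Sym2 V) (a₁ a₂ a₃ b : V) (hb : b ≠ a₂)
    (hW : 0 ≤ massM2 p ends a₁ a₂ a₃ b + deltaT p ends a₁ a₂ a₃ b) :
    Monotone (tau0 p ends a₁ a₂ a₃ b) := by
  intro S S' hSS'
  by_cases hS' : b ∈ S'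
  · rw [tau0_of_mem p ends a₁ a₂ a₃ b hb hS']
    by_cases hS : b ∈ S
    · rw [tau0_of_mem p ends a₁ a₂ a₃ b hb hS]
    · rw [tau0_of_notMem p ends a₁ a₂ a₃ b hS]
      exact tau_le_W_of_notMem p hp ends a₁ a₂ a₃ b hW hS
  · have hS : b ∉ S := fun h => hS' (hSS' h)
    rw [tau0_of_notMem p ends a₁ a₂ a₃ b hS', tau0_of_notMem p ends a₁ a₂ a₃ b hS,
      tau_of_notMem p ends a₁ a₂ a₃ b hS', tau_of_notMem p ends a₁ a₂ a₃ b hS]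
    have h1 := u_mono p hp ends a₂ a₃ hSS'
    have h2 := beta_anti p hp ends a₂ b hSS'
    have h3 := prob_nonneg hp (PDEvent ends a₁ a₂ a₃)
    nlinarith

omit [Fintype V] [DecidableEq V] in
/-- `τ₀ ≥ −P(PD)` when `0 ≤ W` (`b ≠ a₂`). -/
lemma tau0_ge (p : E → R) (hp : IsProbVec p) (ends : E → Sym2 V) (a₁ a₂ a₃ b : V) (hb : b ≠ a₂)
    (hW : 0 ≤ massM2 p ends a₁ a₂ a₃ b + deltaT p ends a₁ a₂ a₃ b) (S : Set V) :
    -prob p (PDEvent ends a₁ a₂ a₃) ≤ tau0 p ends a₁ a₂ a₃ b S := by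
  have h3 := prob_nonneg hp (PDEvent ends a₁ a₂ a₃)
  by_cases hS : b ∈ S
  · rw [tau0_of_mem p ends a₁ a₂ a₃ b hb hS]
    linarith
  · rw [tau0_of_notMem p ends a₁ a₂ a₃ b hS, tau_of_notMem p ends a₁ a₂ a₃ b hS]
    have h1 := u_nonneg p hp ends a₂ a₃ S
    have h2 := beta_le_one p hp ends a₂ b S
    nlinarith

omit [Fintype V] [DecidableEq V] in
/-- **`τ₀ = min(τ, W)` in the regime `W ≤ P(PD)`** (`b ≠ a₂`, `0 ≤ W`). -/
lemma tau0_eq_min (p : E → R) (hp : IsProbVec p) (ends : E → Sym2 V) (a₁ a₂ a₃ b : V) (hb : b ≠ a₂)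
    (hW : 0 ≤ massM2 p ends a₁ a₂ a₃ b + deltaT p ends a₁ a₂ a₃ b)
    (hreg : massM2 p ends a₁ a₂ a₃ b + deltaT p ends a₁ a₂ a₃ b ≤ prob p (PDEvent ends a₁ a₂ a₃))
    (S : Set V) :
    tau0 p ends a₁ a₂ a₃ b S =
      min (tau p ends a₁ a₂ a₃ b S) (massM2 p ends a₁ a₂ a₃ b + deltaT p ends a₁ a₂ a₃ b) := by
  by_cases hS : b ∈ S
  · rw [tau0_of_mem p ends a₁ a₂ a₃ b hb hS, min_eq_right]
    -- on `{b ∈ S}`: `τ = W + (P(PD) − W)(1 − u) ≥ W`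
    unfold tau psi ind
    rw [beta_eq_zero_of_mem p ends hb hS]
    simp only [Set.mem_setOf_eq, hS, Set.indicator_of_mem, Pi.one_apply]
    have h1 := u_le_one p hp ends a₂ a₃ S
    nlinarith
  · rw [tau0_of_notMem p ends a₁ a₂ a₃ b hS, min_eq_left]
    exact tau_le_W_of_notMem p hp ends a₁ a₂ a₃ b hW hS

end Tau

end Lambda

end Summit.Ventures.PercRepro2
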